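import Mathlib
import Summits.KontsevichZagierPeriods.Zeta5Search.ResidueLaw
import Summits.KontsevichZagierPeriods.Zeta5Search.ResidueIdentityProof
import HarnessLib

/-!
# ζ(5) search — PROOF of `ResidueLaw.ResidueIdentityB`: the residue identity for the Brown–Zudilin data `R_b mod p`

HONEST FRAMING: systematic search; no irrationality claim unless certified.

Cell `pub-zeta5`, prover seat p3 (gen 2).  `theorem residueIdentityB_holds : ResidueIdentityB` — the two instances of THEOREM R
(REPORT-gen2-g11 §2) that feed the type-space law, now THEOREMS: with `E = classExp b p` (every pole class of exponent `≥ −M`;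
non-pole classes have `E ≥ 0` automatically, `classExp_nonneg_of_classPoleCount_eq_zero`),
* `p(M−2) + Σ_x E_x ≤ −2 ⇒ Σ_{E=−M} ḡφ̄ + Σ_{E=−M+1} ḡ = 0` (`h = 1` in `residueIdentity_holds`), and
* `p(M−2) + Σ_x E_x ≤ −4 ⇒ sBar2 b p M = 0` (`h = (X + b₀/2)²`, `h(−x) = ā_x²`, `h'(−x) = 2ā_x`),
where `gBar b p x = 2·gBarE p (classExp b p) x` and `phiBar b p x = phiBarE p (classExp b p) x` for `x < p` (`gBar_eq`, `phiBar_eq`).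
Consequence for gen-2 g10's `LawR4`: its two `sBar`-type hypotheses are theorems in the DEG range (to be wired by the typer/P-seats
together with the class-structure hypotheses; not done here).  Nothing here bears on irrationality; no new statements.
-/

open Finset Polynomial

namespace Summit.KontsevichZagierPeriods.Zeta5Search.ResidueLaw

open Summit.KontsevichZagierPeriods.Zeta5Search.ClusterValuation
open Summit.KontsevichZagierPeriods.Zeta5Search.SecondOrder (gBar phiBar)

/-- A class without poles has non-negative class exponent. -/
theorem classExp_nonneg_of_classPoleCount_eq_zero (b : ℕ → ℤ) (p x : ℕ) (h : classPoleCount b p x = 0) :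
    0 ≤ classExp b p x := by
  unfold classPoleCount at h
  rw [Finset.card_eq_zero, Finset.filter_eq_empty_iff] at h
  unfold classExp
  refine add_nonneg (Finset.sum_nonneg fun s hs => not_lt.1 (h hs)) ?_
  split_ifs <;> norm_num

/-- Every class has exponent `≥ −M` as soon as every POLE class has. -/
theorem classExp_ge_of_poles (b : ℕ → ℤ) (p M : ℕ)
    (hE : ∀ x, x < p → 1 ≤ classPoleCount b p x → -(M : ℤ) ≤ classExp b p x) (x : ℕ) (hx : x < p) :
    -(M : ℤ) ≤ classExp b p x := by
  by_cases h0 : classPoleCount b p x = 0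
  · exact le_trans (by simp) (classExp_nonneg_of_classPoleCount_eq_zero b p x h0)
  · exact hE x hx (Nat.one_le_iff_ne_zero.2 h0)

/-- `gBar b p x = 2 · ḡ_x(classExp b p)` for a residue `x < p`. -/
theorem gBar_eq (b : ℕ → ℤ) {p x : ℕ} (hx : x < p) : gBar b p x = 2 * gBarE p (classExp b p) x := by
  unfold gBar gBarE
  rw [Nat.mod_eq_of_lt hx, mul_assoc]

/-- `phiBar b p x = φ̄_x(classExp b p)` for a residue `x < p`. -/
theorem phiBar_eq (b : ℕ → ℤ) {p x : ℕ} (hx : x < p) : phiBar b p x = phiBarE p (classExp b p) x := by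
  unfold phiBar phiBarE
  rw [Nat.mod_eq_of_lt hx]

/-- **`ResidueIdentityB` holds** (both instances of THEOREM R for `R_b mod p`). -/
theorem residueIdentityB_holds : ResidueIdentityB := by
  intro b p M _hb hp hp5 _hb0 hM hE
  have hE' : ∀ x, x < p → -(M : ℤ) ≤ classExp b p x := classExp_ge_of_poles b p M hE
  haveI : Fact p.Prime := ⟨hp⟩
  refine ⟨fun hdeg => ?_, fun hdeg => ?_⟩
  · -- `h = 1`
    have h1 := residueIdentity_holds p M (classExp b p) 1 hp (by omega) hM hE'
      (by rw [natDegree_one]; push_cast; linarith)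
    simp only [derivative_one, eval_zero, zero_mul, zero_add, eval_one, one_mul] at h1
    have h2 : ∀ x ∈ (range p).filter (fun x => classExp b p x = -(M : ℤ)),
        gBar b p x * phiBar b p x = 2 * (gBarE p (classExp b p) x * phiBarE p (classExp b p) x) := by
      intro x hx
      have hxp := Finset.mem_range.1 (Finset.mem_filter.1 hx).1
      rw [gBar_eq b hxp, phiBar_eq b hxp, mul_assoc]
    have h3 : ∀ x ∈ (range p).filter (fun x => classExp b p x = -(M : ℤ) + 1),
        gBar b p x = 2 * gBarE p (classExp b p) x := by
      intro x hx
      exact gBar_eq b (Finset.mem_range.1 (Finset.mem_filter.1 hx).1)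
    rw [Finset.sum_congr rfl h2, Finset.sum_congr rfl h3, ← Finset.mul_sum, ← Finset.mul_sum, ← mul_add, h1,
      mul_zero]
  · -- `h = (X + b₀/2)²`
    set c : ZMod p := ((b 0 : ℤ) : ZMod p) * (2 : ZMod p)⁻¹ with hc
    have hdeg2 : ((X + C c) ^ 2).natDegree = 2 := by
      rw [(monic_X_add_C c).natDegree_pow, natDegree_X_add_C, mul_one]
    have h1 := residueIdentity_holds p M (classExp b p) ((X + C c) ^ 2) hp (by omega) hM hE'
      (by rw [hdeg2]; push_cast; linarith)
    have hev : ∀ x : ℕ, ((X + C c) ^ 2).eval (-(x : ZMod p)) = aBar b p x ^ 2 := by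
      intro x
      rw [eval_pow, eval_add, eval_X, eval_C, aBar, hc]
      ring
    have hev' : ∀ x : ℕ, (derivative ((X + C c) ^ 2)).eval (-(x : ZMod p)) = 2 * aBar b p x := by
      intro x
      rw [derivative_pow, derivative_X_add_C, mul_one, eval_mul, eval_C, pow_one, eval_add, eval_X, eval_C, aBar,
        hc]
      push_cast
      ring
    simp only [hev, hev'] at h1
    unfold sBar2
    have h2 : ∀ x ∈ (range p).filter (fun x => classExp b p x = -(M : ℤ)),
        2 * aBar b p x * gBar b p x + aBar b p x ^ 2 * gBar b p x * phiBar b p x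
          = 2 * (2 * aBar b p x * gBarE p (classExp b p) x
            + aBar b p x ^ 2 * gBarE p (classExp b p) x * phiBarE p (classExp b p) x) := by
      intro x hx
      have hxp := Finset.mem_range.1 (Finset.mem_filter.1 hx).1
      rw [gBar_eq b hxp, phiBar_eq b hxp]
      ring
    have h3 : ∀ x ∈ (range p).filter (fun x => classExp b p x = -(M : ℤ) + 1),
        aBar b p x ^ 2 * gBar b p x = 2 * (aBar b p x ^ 2 * gBarE p (classExp b p) x) := by
      intro x hx
      rw [gBar_eq b (Finset.mem_range.1 (Finset.mem_filter.1 hx).1)]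
      ring
    rw [Finset.sum_congr rfl h2, Finset.sum_congr rfl h3, ← Finset.mul_sum, ← Finset.mul_sum, ← mul_add, h1,
      mul_zero]

end Summit.KontsevichZagierPeriods.Zeta5Search.ResidueLaw
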